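import Literature.NumberTheory.Sieve.LinearEquationsInPrimesComplexityNormalForm
import Literature.NumberTheory.Sieve.LinearEquationsInPrimesLocalObstruction
import HarnessLib

/-!
# Prime parallelograms: a system of four forms of complexity one, and the Main Theorem of Green–Tao 2010 for it (unconditional)

Topic `Literature/NumberTheory/Sieve`. A worked instance — and non-vacuity witness beyond three
forms — of `GreenTao2010_mainTheoremAtComplexity_one`
(`LinearEquationsInPrimesComplexityNormalForm.lean`: the Main Theorem of Green–Tao 2010 for every
system of Cauchy–Schwarz complexity `≤ 1`): the **parallelogram system** (two-dimensional cube,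
Green–Tao 2010, Example 2 with `d = 3`)
`Ψ(n₀, n₁, n₂) = (n₀, n₀ + n₁, n₀ + n₂, n₀ + n₁ + n₂)` on `ℤ³`, `t = 4` forms, which counts
quadruples of primes `p₁ + p₄ = p₂ + p₃` ("prime parallelograms" `x, x + a, x + b, x + a + b`).

* `complexity_parallelogramSystem_le_one` — its complexity is `≤ 1` (Example 2: "if one considers
  the form `n₁`, then one can cover the other `t − 1` forms by `d − 1` classes, with the `i`th class
  consisting of those forms which involve `n_{i+1}` …"), by explicit classes and integer witnesses
  (`not_memAffLinSpan_of_witness`);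
* `isNondegenerateSystem_of_complexity_ne_top` — in general a system of complexity `< ∞` satisfies
  the standing hypotheses of Def. 1.1 (Lemma 1.6 with `IsFiniteComplexitySystem.isNondegenerateSystem`),
  so the nondegeneracy hypothesis of `GreenTao2010_mainTheoremAtComplexity` is implied by the
  complexity hypothesis (`GreenTao2010_mainTheoremAtComplexity.of_complexity_le`);
* `singularProduct_parallelogramSystem_pos` — no local obstruction: `β_p > 0` for every prime
  (the point `(1, 0, 0)` has all four forms `≡ 1`), hence `∏_p β_p > 0`
  (`singularProduct_pos_of_localFactor_pos`);
* `primeParallelograms_vonMangoldt_asymptotic` — **unconditionally, for every `ε > 0`, eventually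
  in `N`, for every convex `K ⊆ [−N, N]³`:
  `|∑_{n ∈ K ∩ ℤ³} Λ(n₀)Λ(n₀+n₁)Λ(n₀+n₂)Λ(n₀+n₁+n₂) − β_∞(K) ∏_p β_p| ≤ ε N³`.**

## References

* [GreenTao2010] B. Green, T. Tao, *Linear equations in primes*, Ann. of Math. 171 (2010),
  1753–1850 (arXiv:math/0606088): Def. 1.1, Def. 1.5, Lemma 1.6, Example 2, Main Theorem
  (Thm. 1.2, finite complexity), Lemma 1.3 (local factors).
-/

noncomputable section

open Finset

namespace Literature.NumberTheory.Sieve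

variable {d t : ℕ}

/-! ### Finite complexity implies the standing hypotheses -/

/-- A system of complexity `< ∞` is nondegenerate in the sense of Def. 1.1: no form is constant
and no two forms are rational multiples of each other (Lemma 1.6: complexity `< ∞` iff no two
linear parts are parallel and no form is constant). [cite: GreenTao2010, Def. 1.1 and Lemma 1.6] -/
theorem isNondegenerateSystem_of_complexity_ne_top {Ψ : Fin t → AffLinForm d}
    (h : complexity Ψ ≠ ⊤) : IsNondegenerateSystem Ψ :=
  (isFiniteComplexitySystem_of_complexity_ne_top h).1.isNondegenerateSystem
    (isFiniteComplexitySystem_of_complexity_ne_top h).2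

/-- A system of complexity `≤ s` is nondegenerate. [cite: GreenTao2010, Def. 1.1 and Lemma 1.6] -/
theorem isNondegenerateSystem_of_complexity_le {Ψ : Fin t → AffLinForm d} {s : ℕ}
    (h : complexity Ψ ≤ s) : IsNondegenerateSystem Ψ :=
  isNondegenerateSystem_of_complexity_ne_top (ne_top_of_le_ne_top (ENat.coe_ne_top s) h)

/-- The Main Theorem at complexity `≤ s` with the (implied) nondegeneracy hypothesis removed.
[cite: GreenTao2010, Main Theorem (Thm. 1.2, finite complexity) and Lemma 1.6] -/
theorem GreenTao2010_mainTheoremAtComplexity.of_complexity_le {s : ℕ}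
    (h : GreenTao2010_mainTheoremAtComplexity s) :
    ∀ (d t L : ℕ), 1 ≤ d → 1 ≤ t → ∀ ε : ℝ, 0 < ε → ∃ N₀ : ℕ, ∀ N : ℕ, N₀ ≤ N →
      ∀ Ψ : Fin t → AffLinForm d, complexity Ψ ≤ s → affLinSize Ψ N ≤ L →
        ∀ K : Set (Fin d → ℝ), Convex ℝ K → K ⊆ realBox d N →
          |vonMangoldtSum Ψ K N - archFactor Ψ K * singularProduct Ψ| ≤ ε * (N : ℝ) ^ d := by
  intro d t L hd ht ε hε
  obtain ⟨N₀, hN₀⟩ := h d t L hd ht ε hε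
  exact ⟨N₀, fun N hN Ψ hc hL K hK hKN =>
    hN₀ N hN Ψ (isNondegenerateSystem_of_complexity_le hc) hc hL K hK hKN⟩

/-! ### The parallelogram system -/

/-- The parallelogram (two-dimensional cube) system `(n₀, n₀ + n₁, n₀ + n₂, n₀ + n₁ + n₂)` on `ℤ³`.
[cite: GreenTao2010, Example 2 (case `d = 3`)] -/
def parallelogramSystem : Fin 4 → AffLinForm 3 :=
  ![⟨![1, 0, 0], 0⟩, ⟨![1, 1, 0], 0⟩, ⟨![1, 0, 1], 0⟩, ⟨![1, 1, 1], 0⟩]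

/-- All constants vanish. [cite: GreenTao2010, Example 2] -/
@[simp] theorem parallelogramSystem_const (i : Fin 4) : (parallelogramSystem i).const = 0 := by
  fin_cases i <;> rfl

/-- `ψ̇₀(f) = f₀`. [cite: GreenTao2010, Example 2] -/
@[simp] theorem linearPart_parallelogramSystem_zero (f : Fin 3 → ℤ) :
    (parallelogramSystem 0).linearPart f = f 0 := by
  simp [parallelogramSystem, AffLinForm.linearPart, Fin.sum_univ_three]

/-- `ψ̇₁(f) = f₀ + f₁`. [cite: GreenTao2010, Example 2] -/
@[simp] theorem linearPart_parallelogramSystem_one (f : Fin 3 → ℤ) :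
    (parallelogramSystem 1).linearPart f = f 0 + f 1 := by
  simp [parallelogramSystem, AffLinForm.linearPart, Fin.sum_univ_three]

/-- `ψ̇₂(f) = f₀ + f₂`. [cite: GreenTao2010, Example 2] -/
@[simp] theorem linearPart_parallelogramSystem_two (f : Fin 3 → ℤ) :
    (parallelogramSystem 2).linearPart f = f 0 + f 2 := by
  simp [parallelogramSystem, AffLinForm.linearPart, Fin.sum_univ_three]

/-- `ψ̇₃(f) = f₀ + f₁ + f₂`. [cite: GreenTao2010, Example 2] -/
@[simp] theorem linearPart_parallelogramSystem_three (f : Fin 3 → ℤ) :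
    (parallelogramSystem 3).linearPart f = f 0 + f 1 + f 2 := by
  simp [parallelogramSystem, AffLinForm.linearPart, Fin.sum_univ_three]

/-- The forms are homogeneous: `ψᵢ(n) = ψ̇ᵢ(n)`. [cite: GreenTao2010, Example 2] -/
theorem eval_parallelogramSystem (i : Fin 4) (n : Fin 3 → ℤ) :
    (parallelogramSystem i).eval n = (parallelogramSystem i).linearPart n := by
  rw [AffLinForm.eval_eq_linearPart_add_const, parallelogramSystem_const, add_zero]

/-- `0`-complexity data for `ψ₀ = n₀`: classes `{ψ₁, ψ₃}` (witness `(1, −1, 0)`) and `{ψ₂}`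
(witness `(1, 0, −1)`). [cite: GreenTao2010, Example 2 and Def. 1.5] -/
theorem hasIComplexityLE_parallelogramSystem_zero : HasIComplexityLE parallelogramSystem 0 1 := by
  refine ⟨![({1, 3} : Finset (Fin 4)), {2}], by decide, Fin.forall_fin_two.mpr ⟨?_, ?_⟩⟩
  · refine not_memAffLinSpan_of_witness ![1, -1, 0] (fun j hj => ?_) (by simp)
    simp only [Matrix.cons_val_zero, Finset.mem_insert, Finset.mem_singleton] at hj
    rcases hj with rfl | rfl <;> simp
  · refine not_memAffLinSpan_of_witness ![1, 0, -1] (fun j hj => ?_) (by simp)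
    simp only [Matrix.cons_val_one, Matrix.cons_val_zero, Finset.mem_singleton] at hj
    subst hj
    simp

/-- `1`-complexity data for `ψ₁ = n₀ + n₁`: classes `{ψ₀, ψ₂}` (witness `(0, 1, 0)`) and `{ψ₃}`
(witness `(1, 0, −1)`). [cite: GreenTao2010, Example 2 and Def. 1.5] -/
theorem hasIComplexityLE_parallelogramSystem_one : HasIComplexityLE parallelogramSystem 1 1 := by
  refine ⟨![({0, 2} : Finset (Fin 4)), {3}], by decide, Fin.forall_fin_two.mpr ⟨?_, ?_⟩⟩
  · refine not_memAffLinSpan_of_witness ![0, 1, 0] (fun j hj => ?_) (by simp)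
    simp only [Matrix.cons_val_zero, Finset.mem_insert, Finset.mem_singleton] at hj
    rcases hj with rfl | rfl <;> simp
  · refine not_memAffLinSpan_of_witness ![1, 0, -1] (fun j hj => ?_) (by simp)
    simp only [Matrix.cons_val_one, Matrix.cons_val_zero, Finset.mem_singleton] at hj
    subst hj
    simp

/-- `2`-complexity data for `ψ₂ = n₀ + n₂`: classes `{ψ₀, ψ₁}` (witness `(0, 0, 1)`) and `{ψ₃}`
(witness `(1, −1, 0)`). [cite: GreenTao2010, Example 2 and Def. 1.5] -/
theorem hasIComplexityLE_parallelogramSystem_two : HasIComplexityLE parallelogramSystem 2 1 := by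
  refine ⟨![({0, 1} : Finset (Fin 4)), {3}], by decide, Fin.forall_fin_two.mpr ⟨?_, ?_⟩⟩
  · refine not_memAffLinSpan_of_witness ![0, 0, 1] (fun j hj => ?_) (by simp)
    simp only [Matrix.cons_val_zero, Finset.mem_insert, Finset.mem_singleton] at hj
    rcases hj with rfl | rfl <;> simp
  · refine not_memAffLinSpan_of_witness ![1, -1, 0] (fun j hj => ?_) (by simp)
    simp only [Matrix.cons_val_one, Matrix.cons_val_zero, Finset.mem_singleton] at hj
    subst hj
    simp

/-- `3`-complexity data for `ψ₃ = n₀ + n₁ + n₂`: classes `{ψ₀, ψ₁}` (witness `(0, 0, 1)`) and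
`{ψ₂}` (witness `(0, 1, 0)`). [cite: GreenTao2010, Example 2 and Def. 1.5] -/
theorem hasIComplexityLE_parallelogramSystem_three :
    HasIComplexityLE parallelogramSystem 3 1 := by
  refine ⟨![({0, 1} : Finset (Fin 4)), {2}], by decide, Fin.forall_fin_two.mpr ⟨?_, ?_⟩⟩
  · refine not_memAffLinSpan_of_witness ![0, 0, 1] (fun j hj => ?_) (by simp)
    simp only [Matrix.cons_val_zero, Finset.mem_insert, Finset.mem_singleton] at hj
    rcases hj with rfl | rfl <;> simp
  · refine not_memAffLinSpan_of_witness ![0, 1, 0] (fun j hj => ?_) (by simp)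
    simp only [Matrix.cons_val_one, Matrix.cons_val_zero, Finset.mem_singleton] at hj
    subst hj
    simp

/-- **The parallelogram system has complexity at most `1`** (Green–Tao: the `(d−1)`-dimensional
cube system has complexity `≤ d − 2`, here `d = 3`). [cite: GreenTao2010, Example 2] -/
theorem complexity_parallelogramSystem_le_one : complexity parallelogramSystem ≤ (1 : ℕ) := by
  refine complexity_le_coe_iff.mpr fun i => ?_
  fin_cases i
  · exact hasIComplexityLE_parallelogramSystem_zero
  · exact hasIComplexityLE_parallelogramSystem_one
  · exact hasIComplexityLE_parallelogramSystem_two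
  · exact hasIComplexityLE_parallelogramSystem_three

/-- The parallelogram system satisfies the standing hypotheses of Def. 1.1.
[cite: GreenTao2010, Def. 1.1 and Example 2] -/
theorem isNondegenerateSystem_parallelogramSystem : IsNondegenerateSystem parallelogramSystem :=
  isNondegenerateSystem_of_complexity_le complexity_parallelogramSystem_le_one

/-- Its size is `‖Ψ‖_N = 1 + 2 + 2 + 3 = 8` at every scale (all constants vanish).
[cite: GreenTao2010, (1.1)] -/
theorem affLinSize_parallelogramSystem (N : ℝ) : affLinSize parallelogramSystem N = 8 := by
  unfold affLinSize
  simp [Fin.sum_univ_four, Fin.sum_univ_three, parallelogramSystem]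
  norm_num

/-- **No local obstruction**: `β_p > 0` for every prime `p` (at `n = (1, 0, 0)` all four forms
take the value `1`, which is coprime to `p`). [cite: GreenTao2010, (1.6) and Lemma 1.3] -/
theorem localFactor_parallelogramSystem_pos {p : ℕ} (hp : p.Prime) :
    0 < localFactor parallelogramSystem p := by
  haveI := Fact.mk hp
  unfold localFactor
  have hp0 : (0 : ℝ) < p := by exact_mod_cast hp.pos
  refine mul_pos (by positivity) ?_
  have hn₀ : (![1, 0, 0] : Fin 3 → ℕ) ∈ Fintype.piFinset fun _ : Fin 3 => range p := by
    refine Fintype.mem_piFinset.mpr fun j => ?_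
    fin_cases j <;> simp [hp.one_lt, hp.pos]
  refine lt_of_lt_of_le ?_ (Finset.single_le_sum
    (fun n _ => Finset.prod_nonneg fun i _ => localVonMangoldt_nonneg _ _) hn₀)
  have hev : ∀ i : Fin 4,
      (parallelogramSystem i).eval (fun j => ((![1, 0, 0] : Fin 3 → ℕ) j : ℤ)) = 1 := by
    intro i
    fin_cases i <;> simp [eval_parallelogramSystem]
  rw [Finset.prod_congr rfl fun i _ => by rw [hev i]]
  refine Finset.prod_pos fun i _ => ?_
  rw [localVonMangoldt_prime hp, Int.cast_one, if_neg one_ne_zero]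
  have h1 : (1 : ℝ) < p := by exact_mod_cast hp.one_lt
  exact div_pos hp0 (by linarith)

/-- **The singular product of the parallelogram system is positive.**
[cite: GreenTao2010, Lemma 1.3 and the sentence following it] -/
theorem singularProduct_parallelogramSystem_pos : 0 < singularProduct parallelogramSystem :=
  singularProduct_pos_of_localFactor_pos _ isNondegenerateSystem_parallelogramSystem
    fun _ hp => localFactor_parallelogramSystem_pos hp

/-- **The generalised Hardy–Littlewood asymptotic for prime parallelograms, unconditionally**:
for every `ε > 0` there is `N₀` such that for all `N ≥ N₀` and every convex `K ⊆ [−N, N]³`,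
`|∑_{n ∈ K ∩ ℤ³} Λ(n₀) Λ(n₀+n₁) Λ(n₀+n₂) Λ(n₀+n₁+n₂) − β_∞(K) ∏_p β_p| ≤ ε N³`, where
`∏_p β_p > 0` (`singularProduct_parallelogramSystem_pos`). An instance of the Main Theorem at
complexity `1` with `t = 4 > 3` forms. [cite: GreenTao2010, Main Theorem and Example 2] -/
theorem primeParallelograms_vonMangoldt_asymptotic :
    ∀ ε : ℝ, 0 < ε → ∃ N₀ : ℕ, ∀ N : ℕ, N₀ ≤ N →
      ∀ K : Set (Fin 3 → ℝ), Convex ℝ K → K ⊆ realBox 3 N →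
        |vonMangoldtSum parallelogramSystem K N -
            archFactor parallelogramSystem K * singularProduct parallelogramSystem| ≤
          ε * (N : ℝ) ^ 3 := by
  intro ε hε
  obtain ⟨N₀, hN₀⟩ := GreenTao2010_mainTheoremAtComplexity_one 3 4 8 (by norm_num) (by norm_num) ε hε
  exact ⟨N₀, fun N hN K hK hKN => hN₀ N hN _ isNondegenerateSystem_parallelogramSystem
    complexity_parallelogramSystem_le_one (affLinSize_parallelogramSystem N).le K hK hKN⟩

end Literature.NumberTheory.Sieve

end
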